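import Literature.AlgebraicGeometry.ShimuraVarieties.KudlaRapoportYang2006.Ch3TraceZeroQuadraticFormHolds
import Literature.NumberTheory.Automorphic.QuaternionGLTwoClassesEmbedding
import Literature.NumberTheory.Automorphic.QuaternionConjugacy
import Literature.NumberTheory.Automorphic.QuaternionAlgebraAdelicNormSqProofs
import Literature.NumberTheory.Automorphic.QuaternionAlgebraAdelicReducedNormMulProofs
import Literature.NumberTheory.Automorphic.QuaternionAlgebraStructure
import Literature.RingTheory.CentralSimple.SkolemNoether
import Mathlib.LinearAlgebra.Alternating.Basic
import Mathlib.LinearAlgebra.Determinant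
import HarnessLib

/-!
# [KudlaRapoportYang2006, §3.2 (3.2.2) (p. 47)] `H = B^× ⥲ GSpin(V, Q)` on `ℚ`-points — DISCHARGED: `KRY2006_3_2_2_conjugation_holds`

Kernel-lane companion of the statement carpet ★ `…/KudlaRapoportYang2006/Ch3CyclesShimuraCurvesI.lean`: its named fact ★
`KRY2006_3_2_2_conjugation` is PROVED here.  THEOREMS ONLY (no definition, no named fact, no `sorry`, no instance, no notation);
cell hodgecm-mathlib, seat B-typ01 (g31); net debt −1.

THE PRINT (KRY2006 §3.2 p. 47): «`H = B^×` […] acts on `V` by conjugation and this induces an isomorphism (3.2.2) `H ⥲ GSpin(V, Q)`.»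
The carpet reads this on `ℚ`-points as three clauses: (1) conjugation by `b ∈ B^×` preserves `V = ker trd` and `Q = nrd`; (2) it is
trivial on `V` iff `b ∈ ℚ^×`; (3) every `ℚ`-linear isometry of `(V, Q)` of determinant `1` is conjugation by some `b ∈ B^×`.

THE PROOF.  (1) `trd(b x b⁻¹) = trd(x)` (★ `reducedTrace_mul_comm`) and `nrd` is multiplicative (★ `reducedNorm_mul_holds`).
(2) `B = ℚ·1 ⊕ V` (`x = trd(x)/2 + (x − trd(x)/2)`, ★ `reducedTrace_algebraMap`), so an element commuting with `V` is central, hence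
a scalar (`Algebra.IsCentral`).  (3) (the content of «`GSpin ⥲`», i.e. Skolem–Noether): for `u, v ∈ V`, `u v + v u` is the scalar
`−(Q(u+v) − Q(u) − Q(v))` (★ `mul_self_of_mem_traceZero`: `v² = −Q(v)`), so an isometry `φ` preserves the symmetric part of the
product and `trd(u v)`; the trilinear form `(u, v, w) ↦ trd(u v w)` on `V` is alternating, hence a multiple of the determinant
(`AlternatingMap.eq_smul_basis_det`, `dim V = 3`), so `φ` of determinant `1` preserves it (`Basis.det_comp`); since `trd(x y)` is
non-degenerate on `V` (checked in a model `ℍ[ℚ, a, b]`, ★ `exists_algEquiv_quaternionAlgebra`, ★ `reducedTrace_quaternionAlgebra`),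
`φ` also preserves the `V`-component of `u v`.  Hence `ψ = id_ℚ ⊕ φ` is a `ℚ`-algebra endomorphism of `B`, inner by Skolem–Noether
(★ `Literature.RingTheory.CentralSimple.exists_units_forall_eq_conj`), and `φ(v) = b v b⁻¹`.
HONEST LABEL: HC_CM is proved only modulo the 7 printed citations (2 remaining: hLiu418, h413) until rung 0 closes; this file is off
that cone, adds no citation debt (0 facts, 0 sorry) and discharges 1 named fact of ★ `Ch3CyclesShimuraCurvesI`.

## References
* [KudlaRapoportYang2006] S. Kudla, M. Rapoport, T. Yang, Modular Forms and Special Cycles on Shimura Curves, Ann. of Math. Stud.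
  161, Princeton 2006, Ch. 3 §3.2 (3.2.2), p. 47.
* [Voight2021] J. Voight, Quaternion Algebras, GTM 288 (2021), §7.7 Main Thm. 7.7.1 (Skolem–Noether).
-/

noncomputable section

namespace Literature.AlgebraicGeometry.ShimuraVarieties.KudlaRapoportYang2006.Ch3CyclesShimuraCurvesI

open Literature.NumberTheory.Automorphic
open scoped Quaternion

universe u

variable {B : Type u} [Ring B] [Algebra ℚ B]

namespace KRY322

/-- Membership in `V = ker trd`. [cite: KudlaRapoportYang2006, §3.2 (3.2.1) (p. 47)] -/
theorem mem_traceZero_iff {x : B} : x ∈ traceZero B ↔ reducedTrace ℚ B x = 0 := LinearMap.mem_ker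

/-- (1a) conjugation preserves `V`: `trd(b x b⁻¹) = trd(x)`. [cite: KudlaRapoportYang2006, §3.2 (3.2.2) (p. 47)] -/
theorem conj_mem_traceZero (b : Bˣ) {x : B} (hx : x ∈ traceZero B) : (↑b * x * ↑b⁻¹ : B) ∈ traceZero B := by
  rw [mem_traceZero_iff] at hx ⊢
  rw [mul_assoc, reducedTrace_mul_comm ℚ, Units.inv_mul_cancel_right, hx]

/-- The scalar ∕ `V` components: `x = trd(x)/2 · 1 + (x − trd(x)/2 · 1)`. [cite: KudlaRapoportYang2006, §3.2 (3.2.1) (p. 47)] -/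
theorem decomp (x : B) :
    x = algebraMap ℚ B (reducedTrace ℚ B x / 2) + (x - algebraMap ℚ B (reducedTrace ℚ B x / 2)) := by abel

/-- (2, ⇐) scalars act trivially. [cite: KudlaRapoportYang2006, §3.2 (3.2.2) (p. 47)] -/
theorem conj_eq_of_mem_range (b : Bˣ) (hb : (b : B) ∈ Set.range (algebraMap ℚ B)) (x : B) : (↑b * x * ↑b⁻¹ : B) = x := by
  obtain ⟨c, hc⟩ := hb
  have hbx : (b : B) * x = x * b := by rw [← hc]; exact Algebra.commutes c x
  rw [hbx, Units.mul_inv_cancel_right]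

section Quaternion

variable [IsQuaternionAlgebra ℚ B]

/-- (1b) conjugation preserves `Q = nrd`. [cite: KudlaRapoportYang2006, §3.2 (3.2.2) (p. 47)] -/
theorem reducedNorm_conj (b : Bˣ) (x : B) : reducedNorm ℚ B (↑b * x * ↑b⁻¹) = reducedNorm ℚ B x := by
  have h1 : reducedNorm ℚ B (↑b : B) * reducedNorm ℚ B (↑b⁻¹ : B) = 1 := by
    rw [← reducedNorm_mul_holds ℚ B (↑b : B) (↑b⁻¹ : B), Units.mul_inv, reducedNorm_one ℚ B]
  rw [reducedNorm_mul_holds ℚ B (↑b * x) (↑b⁻¹ : B), reducedNorm_mul_holds ℚ B (↑b : B) x]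
  calc reducedNorm ℚ B ↑b * reducedNorm ℚ B x * reducedNorm ℚ B ↑b⁻¹
      = reducedNorm ℚ B x * (reducedNorm ℚ B ↑b * reducedNorm ℚ B ↑b⁻¹) := by ring
    _ = reducedNorm ℚ B x := by rw [h1, mul_one]

/-- The `V`-component `x − trd(x)/2` of `x ∈ B = ℚ ⊕ V`. [cite: KudlaRapoportYang2006, §3.2 (3.2.1) (p. 47)] -/
theorem sub_algebraMap_mem_traceZero (x : B) : x - algebraMap ℚ B (reducedTrace ℚ B x / 2) ∈ traceZero B := by
  rw [mem_traceZero_iff, map_sub, reducedTrace_algebraMap ℚ B]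
  ring

/-- (2, ⇒) an element commuting with `V` is central, hence a scalar. [cite: KudlaRapoportYang2006, §3.2 (3.2.2) (p. 47)] -/
theorem mem_range_algebraMap_of_forall_conj_eq (b : Bˣ) (h : ∀ x ∈ traceZero B, (↑b * x * ↑b⁻¹ : B) = x) :
    (b : B) ∈ Set.range (algebraMap ℚ B) := by
  have hcommV : ∀ x ∈ traceZero B, (b : B) * x = x * b := by
    intro x hx
    have := congrArg (· * (b : B)) (h x hx)
    simpa [mul_assoc] using this
  have hcomm : ∀ y : B, y * b = b * y := by
    intro y
    have hy := hcommV _ (sub_algebraMap_mem_traceZero y)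
    rw [mul_sub, sub_mul, Algebra.commutes, sub_left_inj] at hy
    exact hy.symm
  have hmem : (b : B) ∈ Subalgebra.center ℚ B := Subalgebra.mem_center_iff.2 hcomm
  rw [Algebra.IsCentral.center_eq_bot ℚ B] at hmem
  exact Algebra.mem_bot.1 hmem

/-! ### (3): the algebra endomorphism `ψ = id ⊕ φ` and Skolem–Noether -/

/-- `u v + v u = −(Q(u+v) − Q(u) − Q(v))·1` on `V`. [cite: KudlaRapoportYang2006, §3.2 (3.2.1)–(3.2.2) (p. 47)] -/
theorem mul_add_mul_of_mem_traceZero {u v : B} (hu : u ∈ traceZero B) (hv : v ∈ traceZero B) :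
    u * v + v * u = algebraMap ℚ B
      (-(reducedNorm ℚ B (u + v) - reducedNorm ℚ B u - reducedNorm ℚ B v)) := by
  have huv := mul_self_of_mem_traceZero (Submodule.add_mem _ hu hv)
  have hu2 := mul_self_of_mem_traceZero hu
  have hv2 := mul_self_of_mem_traceZero hv
  have : u * v + v * u = (u + v) * (u + v) - u * u - v * v := by noncomm_ring
  rw [this, huv, hu2, hv2, ← map_sub, ← map_sub]
  congr 1
  ring

/-- `trd(u v) = −(Q(u+v) − Q(u) − Q(v))` on `V`. [cite: KudlaRapoportYang2006, §3.2 (3.2.1)–(3.2.2) (p. 47)] -/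
theorem reducedTrace_mul_of_mem_traceZero {u v : B} (hu : u ∈ traceZero B) (hv : v ∈ traceZero B) :
    reducedTrace ℚ B (u * v) = -(reducedNorm ℚ B (u + v) - reducedNorm ℚ B u - reducedNorm ℚ B v) := by
  have h := congrArg (reducedTrace ℚ B) (mul_add_mul_of_mem_traceZero hu hv)
  rw [map_add, reducedTrace_mul_comm ℚ v u, reducedTrace_algebraMap ℚ B] at h
  linarith

/-- `trd(u u w) = 0` for `u, w ∈ V`. [cite: KudlaRapoportYang2006, §3.2 (3.2.2) (p. 47)] -/
theorem reducedTrace_mul_self_mul {u w : B} (hu : u ∈ traceZero B) (hw : w ∈ traceZero B) :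
    reducedTrace ℚ B (u * u * w) = 0 := by
  rw [mul_self_of_mem_traceZero hu, ← Algebra.smul_def, map_smul, (mem_traceZero_iff).1 hw, smul_zero]

/-- `trd(u w w) = 0` for `u, w ∈ V`. [cite: KudlaRapoportYang2006, §3.2 (3.2.2) (p. 47)] -/
theorem reducedTrace_mul_mul_self {u w : B} (hu : u ∈ traceZero B) (hw : w ∈ traceZero B) :
    reducedTrace ℚ B (u * w * w) = 0 := by
  rw [mul_assoc, mul_self_of_mem_traceZero hw, ← Algebra.commutes, ← Algebra.smul_def, map_smul,
    (mem_traceZero_iff).1 hu, smul_zero]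

/-- `trd(u w u) = 0` for `u, w ∈ V`. [cite: KudlaRapoportYang2006, §3.2 (3.2.2) (p. 47)] -/
theorem reducedTrace_mul_mul_self' {u w : B} (hu : u ∈ traceZero B) (hw : w ∈ traceZero B) :
    reducedTrace ℚ B (u * w * u) = 0 := by
  rw [reducedTrace_mul_comm ℚ, ← mul_assoc, reducedTrace_mul_self_mul hu hw]

/-- **Non-degeneracy of `trd(x y)` on `V`**, checked in a model `ℍ[ℚ, a, b]`: if `trd(d w) = 0` for all `w ∈ V` then `d = 0`.
[cite: KudlaRapoportYang2006, §3.2 (3.2.2) (p. 47)] -/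
theorem eq_zero_of_forall_reducedTrace_mul_eq_zero {d : B} (hd : d ∈ traceZero B)
    (h : ∀ w ∈ traceZero B, reducedTrace ℚ B (d * w) = 0) : d = 0 := by
  obtain ⟨a, b, ha, hb, ⟨e⟩⟩ := IsQuaternionAlgebra.exists_algEquiv_quaternionAlgebra ℚ B
  have htr : ∀ y : B, reducedTrace ℚ B y = 2 * (e y).re := fun y => by
    rw [← reducedTrace_algEquiv e y, reducedTrace_quaternionAlgebra]
  have hmem : ∀ q : ℍ[ℚ,a,b], q.re = 0 → e.symm q ∈ traceZero B := fun q hq => by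
    rw [mem_traceZero_iff, htr, e.apply_symm_apply, hq, mul_zero]
  have hre : (e d).re = 0 := by
    have := (mem_traceZero_iff).1 hd; rw [htr] at this; linarith
  have key : ∀ q : ℍ[ℚ,a,b], q.re = 0 → (e d * q).re = 0 := fun q hq => by
    have := h _ (hmem q hq)
    rw [htr, map_mul, e.apply_symm_apply] at this
    linarith
  have hI := key ⟨0, 1, 0, 0⟩ rfl
  have hJ := key ⟨0, 0, 1, 0⟩ rfl
  have hK := key ⟨0, 0, 0, 1⟩ rfl
  simp only [_root_.QuaternionAlgebra.re_mul] at hI hJ hK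
  have hI' : a * (e d).imI = 0 := by linear_combination hI
  have hJ' : b * (e d).imJ = 0 := by linear_combination hJ
  have hK' : (a * b) * (e d).imK = 0 := by linear_combination -hK
  have h1 : (e d).imI = 0 := (mul_eq_zero.1 hI').resolve_left ha
  have h2 : (e d).imJ = 0 := (mul_eq_zero.1 hJ').resolve_left hb
  have h3 : (e d).imK = 0 := (mul_eq_zero.1 hK').resolve_left (mul_ne_zero ha hb)
  have hed : e d = 0 := QuaternionAlgebra.ext hre h1 h2 h3
  exact e.injective (by rw [hed, map_zero])

/-- `dim_ℚ V = 3`. [cite: KudlaRapoportYang2006, §3.2 (3.2.1) (p. 47)] -/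
theorem finrank_traceZero : Module.finrank ℚ (traceZero B) = 3 := by
  have h4 := IsQuaternionAlgebra.finrank_eq_four (K := ℚ) (D := B)
  have hsurj : Function.Surjective (reducedTrace ℚ B) := fun c =>
    ⟨algebraMap ℚ B (c / 2), by rw [reducedTrace_algebraMap ℚ B]; ring⟩
  have hr : Module.finrank ℚ (LinearMap.range (reducedTrace ℚ B)) = 1 := by
    rw [LinearMap.range_eq_top.2 hsurj, finrank_top, Module.finrank_self]
  have := LinearMap.finrank_range_add_finrank_ker (reducedTrace ℚ B)
  rw [hr, h4] at this
  change Module.finrank ℚ (LinearMap.ker (reducedTrace ℚ B)) = 3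
  omega

/-- The trilinear form `(u, v, w) ↦ trd(u v w)` on `V`. [cite: KudlaRapoportYang2006, §3.2 (3.2.2) (p. 47)] -/
theorem exists_alternating_triple :
    ∃ T : (traceZero B) [⋀^Fin 3]→ₗ[ℚ] ℚ,
      ∀ m : Fin 3 → traceZero B, T m = reducedTrace ℚ B ((m 0 : B) * (m 1 : B) * (m 2 : B)) := by
  let M : MultilinearMap ℚ (fun _ : Fin 3 => traceZero B) ℚ :=
    (reducedTrace ℚ B).compMultilinearMap
      ((MultilinearMap.mkPiAlgebraFin ℚ 3 B).compLinearMap fun _ => (traceZero B).subtype)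
  have hM : ∀ m : Fin 3 → traceZero B, M m = reducedTrace ℚ B ((m 0 : B) * (m 1 : B) * (m 2 : B)) := by
    intro m
    simp [M, MultilinearMap.mkPiAlgebraFin_apply, List.ofFn_succ, mul_assoc]
  refine ⟨{ M with
    map_eq_zero_of_eq' := ?_ }, fun m => hM m⟩
  intro m i j hij hne
  change M m = 0
  rw [hM]
  have h0 := (m 0).2; have h1 := (m 1).2; have h2 := (m 2).2
  fin_cases i <;> fin_cases j
  · exact absurd rfl hne
  · rw [show (m 0 : B) = m 1 from congrArg Subtype.val hij]; exact reducedTrace_mul_self_mul h1 h2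
  · rw [show (m 0 : B) = m 2 from congrArg Subtype.val hij]; exact reducedTrace_mul_mul_self' h2 h1
  · rw [show (m 1 : B) = m 0 from congrArg Subtype.val hij]; exact reducedTrace_mul_self_mul h0 h2
  · exact absurd rfl hne
  · rw [show (m 1 : B) = m 2 from congrArg Subtype.val hij]; exact reducedTrace_mul_mul_self h0 h2
  · rw [show (m 2 : B) = m 0 from congrArg Subtype.val hij]; exact reducedTrace_mul_mul_self' h0 h1
  · rw [show (m 2 : B) = m 1 from congrArg Subtype.val hij]; exact reducedTrace_mul_mul_self h0 h1
  · exact absurd rfl hne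

/-- **An isometry of determinant `1` preserves `trd(u v w)` on `V`** (an alternating trilinear form on a `3`-space is a multiple
of the determinant). [cite: KudlaRapoportYang2006, §3.2 (3.2.2) (p. 47)] -/
theorem reducedTrace_triple_map (φ : traceZero B →ₗ[ℚ] traceZero B) (hdet : LinearMap.det φ = 1)
    (u v w : traceZero B) :
    reducedTrace ℚ B ((φ u : B) * (φ v : B) * (φ w : B)) = reducedTrace ℚ B ((u : B) * (v : B) * (w : B)) := by
  obtain ⟨T, hT⟩ := exists_alternating_triple (B := B)
  let bV : Module.Basis (Fin 3) ℚ (traceZero B) := Module.finBasisOfFinrankEq ℚ (traceZero B) finrank_traceZero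
  have hTb := AlternatingMap.eq_smul_basis_det bV T
  have key : ∀ m : Fin 3 → traceZero B, T (φ ∘ m) = T m := by
    intro m
    rw [hTb, AlternatingMap.smul_apply, AlternatingMap.smul_apply, Module.Basis.det_comp, hdet, one_mul]
  have := key ![u, v, w]
  rw [hT, hT] at this
  simpa using this

/-- **The `V`-component identity**: for an isometry `φ` of `(V, Q)` of determinant `1` and `u, v ∈ V`,
`φ(u v − trd(uv)/2) = φu φv − trd(φu φv)/2`. [cite: KudlaRapoportYang2006, §3.2 (3.2.2) (p. 47)] -/
theorem map_pure_mul (φ : traceZero B →ₗ[ℚ] traceZero B)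
    (hiso : ∀ v : traceZero B, reducedNorm ℚ B (φ v : B) = reducedNorm ℚ B (v : B)) (hdet : LinearMap.det φ = 1)
    (u v : traceZero B) :
    (φ ⟨(u : B) * v - algebraMap ℚ B (reducedTrace ℚ B ((u : B) * v) / 2), sub_algebraMap_mem_traceZero _⟩ : B) =
      (φ u : B) * φ v - algebraMap ℚ B (reducedTrace ℚ B ((φ u : B) * φ v) / 2) := by
  -- the polar form is preserved
  have hpol : ∀ x y : traceZero B, reducedTrace ℚ B ((φ x : B) * φ y) = reducedTrace ℚ B ((x : B) * y) := by
    intro x y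
    rw [reducedTrace_mul_of_mem_traceZero (φ x).2 (φ y).2, reducedTrace_mul_of_mem_traceZero x.2 y.2,
      ← Submodule.coe_add, ← map_add, hiso, hiso, hiso, Submodule.coe_add]
  -- `φ` is surjective (`det φ = 1`)
  have hbij : Function.Bijective φ := by
    have hu : IsUnit φ := (LinearMap.isUnit_iff_isUnit_det φ).2 (by rw [hdet]; exact isUnit_one)
    exact (Module.End.isUnit_iff φ).1 hu
  -- test against `φ w`
  set p : traceZero B := ⟨(u : B) * v - algebraMap ℚ B (reducedTrace ℚ B ((u : B) * v) / 2),
    sub_algebraMap_mem_traceZero _⟩ with hp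
  have hpv : (p : B) = (u : B) * v - algebraMap ℚ B (reducedTrace ℚ B ((u : B) * v) / 2) := by rw [hp]
  rw [← sub_eq_zero]
  refine eq_zero_of_forall_reducedTrace_mul_eq_zero
    (Submodule.sub_mem _ (φ p).2 (sub_algebraMap_mem_traceZero _)) fun w hw => ?_
  obtain ⟨w', hw'⟩ := hbij.2 ⟨w, hw⟩
  have hww : w = (φ w' : B) := by rw [hw']
  have e1 : reducedTrace ℚ B ((φ p : B) * φ w') = reducedTrace ℚ B ((u : B) * v * w') := by
    rw [hpol p w', hpv, sub_mul, map_sub, ← Algebra.smul_def, map_smul, (mem_traceZero_iff).1 w'.2, smul_zero,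
      sub_zero]
  have e2 : reducedTrace ℚ B (((φ u : B) * φ v - algebraMap ℚ B (reducedTrace ℚ B ((φ u : B) * φ v) / 2)) * φ w') =
      reducedTrace ℚ B ((u : B) * v * w') := by
    rw [sub_mul, map_sub, ← Algebra.smul_def, map_smul, (mem_traceZero_iff).1 (φ w').2, smul_zero, sub_zero,
      reducedTrace_triple_map φ hdet]
  rw [hww, sub_mul, map_sub, e1, e2, sub_self]

/-- **`ψ = id_ℚ ⊕ φ` is a `ℚ`-algebra endomorphism of `B`** extending the isometry `φ` of determinant `1`.
[cite: KudlaRapoportYang2006, §3.2 (3.2.2) (p. 47)] -/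
theorem exists_algHom_extending (φ : traceZero B →ₗ[ℚ] traceZero B)
    (hiso : ∀ v : traceZero B, reducedNorm ℚ B (φ v : B) = reducedNorm ℚ B (v : B)) (hdet : LinearMap.det φ = 1) :
    ∃ ψ : B →ₐ[ℚ] B, ∀ v : traceZero B, ψ v = φ v := by
  -- the projection `π x = x − trd(x)/2` onto `V` and the linear map `Ψ = trd/2 ⊕ φ ∘ π`
  let π : B →ₗ[ℚ] traceZero B :=
    { toFun := fun x => ⟨x - algebraMap ℚ B (reducedTrace ℚ B x / 2), sub_algebraMap_mem_traceZero x⟩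
      map_add' := fun x y => by
        apply Subtype.ext
        show x + y - algebraMap ℚ B (reducedTrace ℚ B (x + y) / 2) =
          (x - algebraMap ℚ B (reducedTrace ℚ B x / 2)) + (y - algebraMap ℚ B (reducedTrace ℚ B y / 2))
        rw [map_add, add_div, map_add]
        abel
      map_smul' := fun c x => by
        apply Subtype.ext
        show c • x - algebraMap ℚ B (reducedTrace ℚ B (c • x) / 2) = c • (x - algebraMap ℚ B (reducedTrace ℚ B x / 2))
        rw [LinearMap.map_smul, smul_eq_mul, smul_sub, Algebra.smul_def c (algebraMap ℚ B _), ← map_mul, mul_div_assoc] }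
  have hπV : ∀ v : traceZero B, π v = v := fun v => by
    apply Subtype.ext
    show (v : B) - algebraMap ℚ B (reducedTrace ℚ B v / 2) = v
    rw [(mem_traceZero_iff).1 v.2, zero_div, map_zero, sub_zero]
  have hπ1 : π 1 = 0 := by
    apply Subtype.ext
    show (1 : B) - algebraMap ℚ B (reducedTrace ℚ B 1 / 2) = 0
    rw [reducedTrace_one ℚ]
    norm_num
  let Ψ : B →ₗ[ℚ] B :=
    (Algebra.linearMap ℚ B).comp (((1 : ℚ) / 2) • reducedTrace ℚ B) + (traceZero B).subtype.comp (φ.comp π)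
  have hΨ : ∀ x, Ψ x = algebraMap ℚ B ((1 : ℚ) / 2 * reducedTrace ℚ B x) + (φ (π x) : B) := fun x => rfl
  have hΨV : ∀ v : traceZero B, Ψ v = φ v := fun v => by
    rw [hΨ, hπV, (mem_traceZero_iff).1 v.2, mul_zero, map_zero, zero_add]
  have hΨ1 : Ψ 1 = 1 := by
    rw [hΨ, hπ1, map_zero, Submodule.coe_zero, add_zero, reducedTrace_one ℚ]
    norm_num
  have hΨs : ∀ c : ℚ, Ψ (algebraMap ℚ B c) = algebraMap ℚ B c := fun c => by
    rw [Algebra.algebraMap_eq_smul_one, map_smul, hΨ1]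
  -- multiplicativity on pure elements
  have hmulV : ∀ u v : traceZero B, Ψ ((u : B) * v) = Ψ u * Ψ v := by
    intro u v
    rw [hΨV, hΨV, hΨ]
    have hπuv : π ((u : B) * v) = ⟨(u : B) * v - algebraMap ℚ B (reducedTrace ℚ B ((u : B) * v) / 2),
        sub_algebraMap_mem_traceZero _⟩ := rfl
    rw [hπuv, map_pure_mul φ hiso hdet u v]
    have hpol : reducedTrace ℚ B ((φ u : B) * φ v) = reducedTrace ℚ B ((u : B) * v) := by
      rw [reducedTrace_mul_of_mem_traceZero (φ u).2 (φ v).2, reducedTrace_mul_of_mem_traceZero u.2 v.2,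
        ← Submodule.coe_add, ← map_add, hiso, hiso, hiso, Submodule.coe_add]
    rw [hpol, show (1 : ℚ) / 2 * reducedTrace ℚ B ((u : B) * v) = reducedTrace ℚ B ((u : B) * v) / 2 by ring]
    abel
  have hL : ∀ (c : ℚ) (z : B), Ψ (algebraMap ℚ B c * z) = algebraMap ℚ B c * Ψ z := fun c z => by
    rw [← Algebra.smul_def, map_smul, Algebra.smul_def]
  have hR : ∀ (c : ℚ) (z : B), Ψ (z * algebraMap ℚ B c) = Ψ z * algebraMap ℚ B c := fun c z => by
    rw [← Algebra.commutes, hL, Algebra.commutes]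
  have hmul : ∀ x y : B, Ψ (x * y) = Ψ x * Ψ y := by
    intro x y
    have hxu : x = algebraMap ℚ B (reducedTrace ℚ B x / 2) + ((π x : traceZero B) : B) := decomp x
    have hyv : y = algebraMap ℚ B (reducedTrace ℚ B y / 2) + ((π y : traceZero B) : B) := decomp y
    rw [hxu, hyv]
    simp only [add_mul, mul_add, map_add, hL, hR, hmulV, hΨs]
  refine ⟨AlgHom.ofLinearMap Ψ hΨ1 hmul, fun v => ?_⟩
  rw [AlgHom.ofLinearMap_apply, hΨV]

end Quaternion

end KRY322

open KRY322 in
/-- **[KudlaRapoportYang2006, §3.2 (3.2.2) (p. 47)]**, DISCHARGED: for a quaternion algebra `B` over `ℚ`, conjugation by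
`b ∈ B^×` preserves `V = ker trd` and `Q = nrd`; it is trivial on `V` iff `b ∈ ℚ^×`; and every `ℚ`-linear isometry of `(V, Q)` of
determinant `1` is conjugation by some `b ∈ B^×` (Skolem–Noether). [cite: KudlaRapoportYang2006, §3.2 (3.2.2) (p. 47)] -/
theorem KRY2006_3_2_2_conjugation_holds : KRY2006_3_2_2_conjugation B := by
  intro _
  refine ⟨fun b x hx => ⟨conj_mem_traceZero b hx, reducedNorm_conj b x⟩, fun b => ⟨fun h => ?_, fun hb x _ => ?_⟩, ?_⟩
  · exact mem_range_algebraMap_of_forall_conj_eq b h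
  · exact conj_eq_of_mem_range b hb x
  · intro φ hiso hdet
    obtain ⟨ψ, hψ⟩ := exists_algHom_extending φ hiso hdet
    haveI : IsSimpleRing B := IsQuaternionAlgebra.isSimpleRing' ℚ B
    obtain ⟨b, hb⟩ := Literature.RingTheory.CentralSimple.exists_units_forall_eq_conj ψ
    exact ⟨b, fun v => by rw [← hψ, hb]⟩

end Literature.AlgebraicGeometry.ShimuraVarieties.KudlaRapoportYang2006.Ch3CyclesShimuraCurvesI

end
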